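import Literature.NumberTheory.Transcendental.KaehlerHodgeEllipticReductionProofs
import Literature.NumberTheory.Transcendental.KaehlerHodgeHarmonicClosedProofs
import Literature.NumberTheory.Transcendental.DolbeaultIntegrabilityProofs
import Literature.NumberTheory.Transcendental.DolbeaultFiniteOfHodgeProofs
import HarnessLib

/-!
# Harmonic representatives of Dolbeault classes, and Cartan–Serre finiteness, from Warner's
# analytic theorems 6.5 and 6.6 for `Δ_∂̄` (Voisin, Thm. 5.24 and Cor. 5.25)

Companion of `KaehlerHodgeEllipticReductionProofs.lean`, which reduces the decomposition
`A^{p,q}(M) = ℋ^{p,q} + Δ_∂̄(A^{p,q}(M))` and the finite-dimensionality of `ℋ^{p,q}` (C. Voisin,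
*Hodge Theory and Complex Algebraic Geometry I* (2002), Thm. 5.24 (i), (ii)) to Warner's Theorems
6.5 (regularity) and 6.6 (compactness) for `Δ_∂̄` on the inner product space `A^{p,q}(M)`
(`CL2SmoothForms.pq o p q`, `CL2SmoothForms.pqLaplacian o hJ p q h`). Here the decomposition is
turned into the **Hodge theorem for `∂̄`** as stated in the tree — the named facts of
`KaehlerHodge.lean` — and into its consequences, all from the same two analytic hypotheses:

* `dolbeaultBarₗ`, `dolbeaultExactForms_succ_eq_range` — `B^{p,q+1}_{∂̄} = ∂̄(A^{p,q})` (`∂̄` is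
  linear on the smooth `(p,q)`-forms, so the span in `dolbeaultExactForms` adds nothing);
* `IsOfType.dolbeaultBarAdjoint` — `∂̄* : A^{p,q+1} → A^{p,q}` (Huybrechts (2005), Def. 3.1.3);
* `eq_zero_of_isDolbeaultHarmonic_of_mem_dolbeaultExactForms` — a `∂̄`-exact `∂̄`-harmonic form
  vanishes (`‖∂̄β‖² = ⟨β, ∂̄*∂̄β⟩ = 0`; Voisin, proof of Thm. 5.24 / Huybrechts, Cor. 3.2.9 proof),
  whence **uniqueness** of harmonic representatives;
* `exists_isDolbeaultHarmonic_mk_eq_of_regularity_of_compactness` — **existence**: for a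
  `∂̄`-closed smooth `(p,q)`-form `α = η + Δ_∂̄ w` (Thm. 5.24 (i) from 6.5/6.6), `∂̄α = ∂̄η = 0` and
  `∂̄² = 0` give `∂̄(∂̄*∂̄w) = 0`, so `‖∂̄*∂̄w‖² = ⟨∂̄w, ∂̄∂̄*∂̄w⟩ = 0` and `α = η + ∂̄(∂̄*w)` with
  `∂̄*w ∈ A^{p,q-1}`: `[α] = [η]` (the argument printed by Gilkey (1995), proof of Thm. 1.5.2, and by
  Voisin after Thm. 5.24; bidegrees `q = 0` need no analysis: there `∂̄*` vanishes on `A^{p,0}` and a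
  `∂̄`-closed form is already harmonic);
* `existsUnique_isDolbeaultHarmonic_mk_eq_of_regularity_of_compactness` — **the named fact
  `existsUnique_isDolbeaultHarmonic_mk_eq g o`** (every Dolbeault class has a unique `Δ_∂̄`-harmonic
  representative; Voisin, Thm. 5.24 / §5.3.1) **from Warner 6.5 and 6.6 for `Δ_∂̄` on each
  `A^{p,q}(M)`**;
* `finite_dolbeaultCohomology_of_regularity_of_compactness` — **Cartan–Serre finiteness
  `finite_dolbeaultCohomology` from the same hypotheses** (for every compact complex manifold, via
  `finite_dolbeaultCohomology_of_hodgeTheory` and `finite_dolbeaultHarmonicForms_of_compactness`).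

No named fact is introduced. After this file the analytic content of the Hodge theorem for `∂̄`
(and of `finite_dolbeaultCohomology`, `finrank_complexDeRham_le_sum_hodgeNumber`, …) that remains
unproved in the tree is exactly Warner's 6.5 and 6.6 for the elliptic operator `Δ_∂̄` on
`A^{p,q}(M)`: Voisin's Thm. 5.22 ("which we will use without proof").

## References

* C. Voisin, *Hodge Theory and Complex Algebraic Geometry I* (2002), §5.1.3–5.1.4 (Lemma 5.8,
  Cor. 5.13, Def. 5.14), §5.2.3 Thm. 5.22, §5.3.1 Thm. 5.24, Cor. 5.25.
  [cite: VoisinHodgeI2002, Thm. 5.24 and Cor. 5.25]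
* P. B. Gilkey, *Invariance theory, the heat equation, and the Atiyah–Singer index theorem* (1995),
  Thm. 1.5.2 (proof). [cite: Gilkey1995, Thm. 1.5.2]
* F. W. Warner, *Foundations of Differentiable Manifolds and Lie Groups*, GTM 94 (1983), 6.5, 6.6.
-/

noncomputable section

open scoped Manifold ContDiff Topology ComplexConjugate ComplexInnerProductSpace
open Bundle Module Filter Literature.Geometry.Kaehler Literature.Analysis.OperatorTheory

namespace Literature.NumberTheory.Transcendental

-- The identification `TangentSpace I x = E` is an abuse of definitional equality (see
-- `NormedSpace.fromTangentSpace`); as in Mathlib's tangent-bundle files we let `isDefEq` unfold it.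
set_option backward.isDefEq.respectTransparency false

variable {E : Type*} [NormedAddCommGroup E] [NormedSpace ℂ E]
  {M : Type*} [TopologicalSpace M] [ChartedSpace E M]
  [IsManifold 𝓘(ℂ, E) ω M] [IsManifold 𝓘(ℝ, E) ∞ M]

/-! ### `B^{p,q+1}_{∂̄} = ∂̄(A^{p,q})` and the type of `∂̄*` -/

variable (E M) in
/-- `∂̄` restricted to the smooth `(p,q)`-forms, as a `ℂ`-linear map `A^{p,q}(M) → A^{p+q+1}(M; ℂ)`
(additive on smooth forms, `dolbeaultBar_add'`; homogeneous, `dolbeaultBar_smul_holds`).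
Voisin (2002), §2.3.3. [cite: VoisinHodgeI2002, §2.3.3] -/
def dolbeaultBarₗ (p q : ℕ) : ↥(pqForms E M p q) →ₗ[ℂ] MForm 𝓘(ℝ, E) M ℂ (p + q + 1) where
  toFun w := dolbeaultBar (w : MForm 𝓘(ℝ, E) M ℂ (p + q))
  map_add' w w' := by
    obtain ⟨hw, -⟩ := (mem_pqForms_iff _).mp w.2
    obtain ⟨hw', -⟩ := (mem_pqForms_iff _).mp w'.2
    exact dolbeaultBar_add' hw hw'
  map_smul' c w := by
    simp only [Submodule.coe_smul, RingHom.id_apply]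
    exact dolbeaultBar_smul_holds c _

/-- **`B^{p,q+1}_{∂̄}(M) = ∂̄(A^{p,q}(M))`**: the `∂̄`-exact `(p,q+1)`-forms are exactly the range of
`∂̄` on the smooth `(p,q)`-forms (the span in the definition of `dolbeaultExactForms` adds nothing,
`∂̄` being linear there). Voisin (2002), §2.3.3. [cite: VoisinHodgeI2002, §2.3.3] -/
theorem dolbeaultExactForms_succ_eq_range (p q : ℕ) :
    dolbeaultExactForms E M p (q + 1) = LinearMap.range (dolbeaultBarₗ E M p q) := by
  change Submodule.span ℂ (dolbeaultBar '' (pqForms E M p q : Set (MForm 𝓘(ℝ, E) M ℂ (p + q)))) = _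
  refine Submodule.span_eq_of_le _ ?_ ?_
  · rintro _ ⟨w, hw, rfl⟩
    exact ⟨⟨w, hw⟩, rfl⟩
  · rintro _ ⟨w, rfl⟩
    exact Submodule.subset_span ⟨w, w.2, rfl⟩

variable [FiniteDimensional ℂ E] {n : ℕ} [Fact (finrank ℝ E = n)]
  [RiemannianBundle (fun x : M ↦ TangentSpace 𝓘(ℝ, E) x)]
  (o : (x : M) → Orientation ℝ (TangentSpace 𝓘(ℝ, E) x) (Fin n)) {k m : ℕ}

omit [IsManifold 𝓘(ℂ, E) ω M] [IsManifold 𝓘(ℝ, E) ∞ M] in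
/-- **`∂̄*` lowers the type by `(0,1)`: `∂̄* : A^{p,q+1} → A^{p,q}`** for a Hermitian metric
(instance form `hJ`), Huybrechts (2005), Def. 3.1.3 / Voisin (2002), §5.1.3 — from
`dolbeaultBarAdjoint_typeComponent`. [cite: VoisinHodgeI2002, §5.1.3] -/
theorem IsOfType.dolbeaultBarAdjoint
    (hJ : ∀ (x : M) (v w : TangentSpace 𝓘(ℝ, E) x),
      inner ℝ (tangentJ E x v) (tangentJ E x w) = inner ℝ v w)
    (h : (k + 1) + m = n) {p q : ℕ} {γ : MForm 𝓘(ℝ, E) M ℂ (k + 1)} (hγ : IsOfType p (q + 1) γ) :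
    IsOfType p q (dolbeaultBarAdjoint o h γ) := by
  have hpq : p + q = k := by have := hγ.add_eq; omega
  have := dolbeaultBarAdjoint_typeComponent o hJ h p q γ
  rw [hγ.typeComponent_eq_self] at this
  rw [this]
  exact isOfType_typeComponent_holds hpq _

/-! ### A `∂̄`-exact harmonic form vanishes; uniqueness of harmonic representatives -/

section Unique

variable [MeasurableSpace E] [BorelSpace E] [T2Space M] [CompactSpace M]
  [IsContinuousRiemannianBundle E (fun x : M ↦ TangentSpace 𝓘(ℝ, E) x)]
  [IsContMDiffRiemannianBundle 𝓘(ℝ, E) ∞ E (fun x : M ↦ TangentSpace 𝓘(ℝ, E) x)]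

/-- **A `∂̄`-exact `Δ_∂̄`-harmonic form is zero** (compact complex manifold, smooth Hermitian metric
in the instance form `hJ`, `vol_o` smooth): if `γ ∈ B^{p,q}_{∂̄}` is `∂̄`-harmonic of type `(p,q)`
then `γ = 0`. For `q = 0` there are no exact forms; for `q ≥ 1`, `γ = ∂̄β` with `β ∈ A^{p,q-1}`
(`dolbeaultExactForms_succ_eq_range`) and `∂̄*γ = 0` (Cor. 5.13,
`isDolbeaultHarmonic_iff_of_inner_tangentJ`), so `⟪γ, γ⟫ = ⟪∂̄β, γ⟫ = ⟪β, ∂̄*γ⟫ = 0` (Lemma 5.8,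
`MForm.cl2Inner_dolbeaultBar_left_of_isHermitian`) and `γ = 0` by definiteness. This is the
uniqueness half of Voisin (2002), Thm. 5.24 / §5.3.1 ("a `∂̄`-closed form … harmonic if and only if
it is of minimal norm among representatives"); Huybrechts (2005), proof of Cor. 3.2.9.
[cite: VoisinHodgeI2002, Thm. 5.24] -/
theorem eq_zero_of_isDolbeaultHarmonic_of_mem_dolbeaultExactForms
    (hJ : ∀ (x : M) (v w : TangentSpace 𝓘(ℝ, E) x),
      inner ℝ (tangentJ E x v) (tangentJ E x w) = inner ℝ v w)
    (ho : IsSmoothForm (riemannianVolumeForm o)) {p q : ℕ} (h : (p + q) + m = n)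
    {γ : MForm 𝓘(ℝ, E) M ℂ (p + q)} (hγ : IsDolbeaultHarmonic o p q h γ)
    (hex : γ ∈ dolbeaultExactForms E M p q) : γ = 0 := by
  rcases q with - | q
  · simpa using hex
  · rw [dolbeaultExactForms_succ_eq_range, LinearMap.mem_range] at hex
    obtain ⟨β, hβ⟩ := hex
    obtain ⟨hβs, hβt⟩ := (mem_pqForms_iff _).mp β.2
    change dolbeaultBar (β : MForm 𝓘(ℝ, E) M ℂ (p + q)) = γ at hβ
    have h' : (p + q + 1) + m = n := by omega
    have hadj : dolbeaultBarAdjoint o h' γ = 0 :=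
      ((isDolbeaultHarmonic_iff_of_inner_tangentJ o hJ ho h' hγ.1 hγ.2.1).1 hγ).2
    have h0 : MForm.cl2Inner o γ γ = 0 := by
      rw [← hβ, MForm.cl2Inner_dolbeaultBar_left_of_isHermitian o hJ ho h' hβs (hβ ▸ hγ.1), hβ,
        hadj, MForm.cl2Inner_zero_right]
    exact eq_zero_of_cl2Inner_self_eq_zero o ho h hγ.1 h0

/-- **Uniqueness of the `Δ_∂̄`-harmonic representative of a Dolbeault class** (Voisin (2002),
Thm. 5.24; Huybrechts (2005), Cor. 3.2.9): two `∂̄`-harmonic `∂̄`-closed `(p,q)`-forms with the same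
class coincide (their difference is harmonic and `∂̄`-exact). [cite: VoisinHodgeI2002, Thm. 5.24] -/
theorem isDolbeaultHarmonic_rep_unique
    (hJ : ∀ (x : M) (v w : TangentSpace 𝓘(ℝ, E) x),
      inner ℝ (tangentJ E x v) (tangentJ E x w) = inner ℝ v w)
    (ho : IsSmoothForm (riemannianVolumeForm o)) {p q : ℕ} (h : (p + q) + m = n)
    {α β : dolbeaultClosedForms E M p q}
    (hα : IsDolbeaultHarmonic o p q h (α : MForm 𝓘(ℝ, E) M ℂ (p + q)))
    (hβ : IsDolbeaultHarmonic o p q h (β : MForm 𝓘(ℝ, E) M ℂ (p + q)))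
    (hc : dolbeaultCohomology.mk E M p q α = dolbeaultCohomology.mk E M p q β) : α = β := by
  have hdiff : IsDolbeaultHarmonic o p q h ((α : MForm 𝓘(ℝ, E) M ℂ (p + q)) - β) := by
    have := IsDolbeaultHarmonic.add o ho h hα (IsDolbeaultHarmonic.smul o h hβ (-1))
    simpa [sub_eq_add_neg] using this
  have hex := (dolbeaultCohomology.mk_eq_mk_iff α β).1 hc
  have h0 := eq_zero_of_isDolbeaultHarmonic_of_mem_dolbeaultExactForms o hJ ho h hdiff hex
  exact Subtype.ext (sub_eq_zero.1 h0)

end Unique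

/-! ### Existence of harmonic representatives from the decomposition -/

section Existence

variable [MeasurableSpace E] [BorelSpace E] [T2Space M] [CompactSpace M]
  [IsContinuousRiemannianBundle E (fun x : M ↦ TangentSpace 𝓘(ℝ, E) x)]
  [IsContMDiffRiemannianBundle 𝓘(ℝ, E) ∞ E (fun x : M ↦ TangentSpace 𝓘(ℝ, E) x)]
  [Fact (IsSmoothForm (riemannianVolumeForm o))]

omit [MeasurableSpace E] [BorelSpace E] in
/-- **A `∂̄`-closed smooth `(p,0)`-form is `Δ_∂̄`-harmonic** (no analysis): `∂̄*` vanishes on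
`A^{p,0}` (`dolbeaultBarAdjoint_typeComponent_zero`), so `Δ_∂̄ α = ∂̄∂̄*α + ∂̄*∂̄α = 0`.
Voisin (2002), §5.1.3–5.1.4. [cite: VoisinHodgeI2002, §5.1.4, Def. 5.14] -/
theorem isDolbeaultHarmonic_of_dolbeaultBar_eq_zero_of_type_zero
    (hJ : ∀ (x : M) (v w : TangentSpace 𝓘(ℝ, E) x),
      inner ℝ (tangentJ E x v) (tangentJ E x w) = inner ℝ v w)
    {p : ℕ} (h : (p + 0) + m = n) {α : MForm 𝓘(ℝ, E) M ℂ (p + 0)} (hα : IsSmoothForm α)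
    (ht : IsOfType p 0 α) (hd : dolbeaultBar α = 0) : IsDolbeaultHarmonic o p 0 h α := by
  refine ⟨hα, ht, ?_⟩
  rcases p with - | p
  · -- degree `0`: `Δ = ∂̄*∂̄`
    rcases m with - | m
    · rfl
    · change dolbeaultBarAdjoint o _ (dolbeaultBar α) = 0
      rw [hd, dolbeaultBarAdjoint_zero]
  · -- positive degree: `∂̄α = 0` and `∂̄*α = ∂̄*(α^{p+1,0}) = 0`
    have h1 : (p + 1) + m = n := by omega
    have hadj : ∀ (h' : (p + 1) + m = n), dolbeaultBarAdjoint o h' α = 0 := fun h' ↦ by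
      have := dolbeaultBarAdjoint_typeComponent_zero o hJ h' (p + 1) α
      rwa [ht.typeComponent_eq_self] at this
    exact ((isDolbeaultHarmonic_iff_of_inner_tangentJ o hJ Fact.out h hα ht).2 ⟨hd, hadj _⟩).2.2

/-- **Existence of a `Δ_∂̄`-harmonic representative in every Dolbeault class, from Warner's
Theorems 6.5 and 6.6 for `Δ_∂̄` on `A^{p,q}(M)`** (Voisin (2002), Thm. 5.24 ⇒ §5.3.1; the argument
of Gilkey (1995), proof of Thm. 1.5.2). Setting as in
`exists_isDolbeaultHarmonic_add_dolbeaultLaplacian_of_regularity_of_compactness` (compact complex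
manifold, smooth Hermitian metric in the instance form `hJ`, `vol_o` smooth as a `Fact`), with the
same two hypotheses `hC` (6.6) and `hR` (6.5). For `q = 0` every `∂̄`-closed `(p,0)`-form is
harmonic (`isDolbeaultHarmonic_of_dolbeaultBar_eq_zero_of_type_zero`). For `q ≥ 1`, decompose a
closed `α = η + Δ_∂̄ w` with `η ∈ ℋ^{p,q}`, `w ∈ A^{p,q}`; in top degree `Δ_∂̄ w = ∂̄(∂̄*w)`, and
otherwise `Δ_∂̄ w = ∂̄(∂̄*w) + ∂̄*(∂̄w)` where `θ = ∂̄*(∂̄w)` is `∂̄`-closed (`∂̄α = ∂̄η = 0`,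
`∂̄² = 0`) so that `⟪θ, θ⟫ = ⟪∂̄w, ∂̄θ⟫ = 0`, `θ = 0`; in both cases `α - η = ∂̄(∂̄*w)` with
`∂̄*w ∈ A^{p,q-1}`, i.e. `[α] = [η]`. [cite: VoisinHodgeI2002, Thm. 5.24] -/
theorem exists_isDolbeaultHarmonic_mk_eq_of_regularity_of_compactness
    (hJ : ∀ (x : M) (v w : TangentSpace 𝓘(ℝ, E) x),
      inner ℝ (tangentJ E x v) (tangentJ E x w) = inner ℝ v w)
    {p q : ℕ} (h : (p + q) + m = n)
    (hC : ∀ (u : ℕ → CL2SmoothForms.pq o p q) (c : ℝ), (∀ i, ‖u i‖ ≤ c) →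
      (∀ i, ‖CL2SmoothForms.pqLaplacian o hJ p q h (u i)‖ ≤ c) →
        ∃ φ : ℕ → ℕ, StrictMono φ ∧ CauchySeq (u ∘ φ))
    (hR : ∀ (α : CL2SmoothForms.pq o p q) (ℓ : CL2SmoothForms.pq o p q →L[ℂ] ℂ),
      (∀ φ, ℓ (CL2SmoothForms.pqLaplacian o hJ p q h φ) = ⟪α, φ⟫) →
        ∃ w : CL2SmoothForms.pq o p q, ∀ φ, ℓ φ = ⟪w, φ⟫)
    (c : dolbeaultCohomology E M p q) :
    ∃ η : dolbeaultClosedForms E M p q,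
      IsDolbeaultHarmonic o p q h (η : MForm 𝓘(ℝ, E) M ℂ (p + q)) ∧
        dolbeaultCohomology.mk E M p q η = c := by
  have ho : IsSmoothForm (riemannianVolumeForm o) := Fact.out
  obtain ⟨α₀, rfl⟩ := dolbeaultCohomology.mk_surjective c
  obtain ⟨hαs, hαt, hαd⟩ := (mem_dolbeaultClosedForms_iff (E := E) (M := M)
    isSmoothForm_typeComponent_holds dolbeaultBar_smul_holds (α₀ : MForm 𝓘(ℝ, E) M ℂ (p + q))).1 α₀.2
  -- it suffices to find a harmonic `η` with `α₀ - η` exact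
  suffices H : ∃ η : MForm 𝓘(ℝ, E) M ℂ (p + q), IsDolbeaultHarmonic o p q h η ∧
      (α₀ : MForm 𝓘(ℝ, E) M ℂ (p + q)) - η ∈ dolbeaultExactForms E M p q by
    obtain ⟨η, hη, hex⟩ := H
    refine ⟨⟨η, mem_dolbeaultClosedForms hη.1 hη.2.1 (hη.dolbeaultBar_eq_zero o hJ ho h)⟩, hη, ?_⟩
    rw [dolbeaultCohomology.mk_eq_mk_iff]
    simpa using Submodule.neg_mem _ hex
  rcases q with - | q
  · -- `q = 0`: `α₀` itself is harmonic
    exact ⟨α₀, isDolbeaultHarmonic_of_dolbeaultBar_eq_zero_of_type_zero o hJ h hαs hαt hαd,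
      by simp⟩
  · -- `q ≥ 1`: decompose `α₀ = η + Δ w`
    obtain ⟨η, w, hη, hws, hwt, hdec⟩ :=
      exists_isDolbeaultHarmonic_add_dolbeaultLaplacian_of_regularity_of_compactness o hJ h hC hR
        hαs hαt
    refine ⟨η, hη, ?_⟩
    have h1 : (p + q + 1) + m = n := by omega
    -- `∂̄* w ∈ A^{p,q}` and `∂̄(∂̄* w)` is exact
    have hBs : IsSmoothForm (dolbeaultBarAdjoint o h1 w) := IsSmoothForm.dolbeaultBarAdjoint o ho h1 hws
    have hBt : IsOfType p q (dolbeaultBarAdjoint o h1 w) := hwt.dolbeaultBarAdjoint o hJ h1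
    have hexact : dolbeaultBar (dolbeaultBarAdjoint o h1 w) ∈ dolbeaultExactForms E M p (q + 1) :=
      dolbeaultBar_mem_dolbeaultExactForms ((mem_pqForms_iff _).2 ⟨hBs, hBt⟩)
    -- it remains to see `α₀ - η = ∂̄(∂̄* w)`, i.e. `Δ w = ∂̄(∂̄* w)`
    suffices hΔ : dolbeaultLaplacian o (p + (q + 1)) m h w = dolbeaultBar (dolbeaultBarAdjoint o h1 w) by
      rw [hdec, add_sub_cancel_left, hΔ]
      exact hexact
    rcases m with - | m
    · -- top degree: `Δ w = ∂̄ ∂̄* w` by definition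
      rfl
    · -- generic degree: `Δ w = ∂̄∂̄*w + ∂̄*∂̄w` and `θ = ∂̄*∂̄w = 0`
      have h2 : (p + q + 1 + 1) + m = n := by omega
      have hΔdef : dolbeaultLaplacian o (p + (q + 1)) (m + 1) h w =
          dolbeaultBar (dolbeaultBarAdjoint o h1 w) + dolbeaultBarAdjoint o h2 (dolbeaultBar w) := rfl
      have hdws : IsSmoothForm (dolbeaultBar w) := hws.dolbeaultBar
      have hθs : IsSmoothForm (dolbeaultBarAdjoint o h2 (dolbeaultBar w)) :=
        IsSmoothForm.dolbeaultBarAdjoint o ho h2 hdws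
      -- `∂̄θ = 0` for `θ = ∂̄*∂̄w`: apply `∂̄` to `α₀ = η + ∂̄∂̄*w + θ`
      have hdθ : dolbeaultBar (dolbeaultBarAdjoint o h2 (dolbeaultBar w)) = 0 := by
        have hdη : dolbeaultBar η = 0 := hη.dolbeaultBar_eq_zero o hJ ho h
        have hdd : dolbeaultBar (dolbeaultBar (dolbeaultBarAdjoint o h1 w)) = 0 :=
          dolbeaultBar_dolbeaultBar_holds hBs
        have := congrArg dolbeaultBar hdec
        rw [hΔdef, hαd, dolbeaultBar_add' hη.1 (hBs.dolbeaultBar.add hθs),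
          dolbeaultBar_add' hBs.dolbeaultBar hθs, hdη, hdd, zero_add, zero_add] at this
        exact this.symm
      -- `⟪θ, θ⟫ = ⟪∂̄w, ∂̄θ⟫ = 0`, so `θ = 0`
      have hθ0 : dolbeaultBarAdjoint o h2 (dolbeaultBar w) = 0 := by
        have h0 : MForm.cl2Inner o (dolbeaultBarAdjoint o h2 (dolbeaultBar w))
            (dolbeaultBarAdjoint o h2 (dolbeaultBar w)) = 0 := by
          rw [cl2Inner_dolbeaultBarAdjoint_left_of_isHermitian o hJ ho h2 hθs hdws, hdθ,
            MForm.cl2Inner_zero_right]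
        exact eq_zero_of_cl2Inner_self_eq_zero o ho h1 hθs h0
      rw [hΔdef, hθ0, add_zero]

end Existence

/-! ### The named facts from Warner 6.5 and 6.6 for `Δ_∂̄` -/

section NamedFacts

omit [RiemannianBundle (fun x : M ↦ TangentSpace 𝓘(ℝ, E) x)]

/-- **The Hodge theorem for `∂̄` — the named fact `existsUnique_isDolbeaultHarmonic_mk_eq g o` —
from Warner's Theorems 6.5 (regularity) and 6.6 (compactness) for `Δ_∂̄` on the spaces
`A^{p,q}(M)`** (Voisin (2002), Thm. 5.24 with §5.3.1, from Thm. 5.22; Warner (1983), pp. 222–224).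
On a compact complex manifold `M` with the `C^∞` metric `g` (Hermitian, `hg`, inside the fact) and
orientation family `o`: if for every bidegree `(p,q)` with `(p + q) + m = n` the operator
`Δ_∂̄ : A^{p,q} → A^{p,q}` (`CL2SmoothForms.pqLaplacian`) satisfies 6.6 (`hC`) and 6.5 (`hR`) on the
Hermitian inner product space `A^{p,q}(M)`, then every Dolbeault class has a unique `Δ_∂̄`-harmonic
representative (`exists_isDolbeaultHarmonic_mk_eq_of_regularity_of_compactness`,
`isDolbeaultHarmonic_rep_unique`). The Borel structure used for the `L²` products is the canonical
one. [cite: VoisinHodgeI2002, Thm. 5.24] -/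
theorem existsUnique_isDolbeaultHarmonic_mk_eq_of_regularity_of_compactness
    (g : ContMDiffRiemannianMetric 𝓘(ℝ, E) ∞ E (fun x : M ↦ TangentSpace 𝓘(ℝ, E) x))
    (o : (x : M) → Orientation ℝ (TangentSpace 𝓘(ℝ, E) x) (Fin n))
    (hC : ∀ [MeasurableSpace E] [BorelSpace E] [CompactSpace M] [T2Space M]
      (hJ : letI : RiemannianBundle (fun x : M ↦ TangentSpace 𝓘(ℝ, E) x) := ⟨g.toRiemannianMetric⟩
        ∀ (x : M) (v w : TangentSpace 𝓘(ℝ, E) x),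
          inner ℝ (tangentJ E x v) (tangentJ E x w) = inner ℝ v w)
      (p q : ℕ) (h : (p + q) + m = n)
      (ho : letI : RiemannianBundle (fun x : M ↦ TangentSpace 𝓘(ℝ, E) x) := ⟨g.toRiemannianMetric⟩
        IsSmoothForm (riemannianVolumeForm o)),
      letI : RiemannianBundle (fun x : M ↦ TangentSpace 𝓘(ℝ, E) x) := ⟨g.toRiemannianMetric⟩
      haveI : IsContMDiffRiemannianBundle 𝓘(ℝ, E) ∞ E (fun x : M ↦ TangentSpace 𝓘(ℝ, E) x) :=
        ⟨g.inner, g.contMDiff, fun _ _ _ ↦ rfl⟩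
      haveI : Fact (IsSmoothForm (riemannianVolumeForm o)) := ⟨ho⟩
      ∀ (u : ℕ → CL2SmoothForms.pq o p q) (c : ℝ), (∀ i, ‖u i‖ ≤ c) →
        (∀ i, ‖CL2SmoothForms.pqLaplacian o hJ p q h (u i)‖ ≤ c) →
          ∃ φ : ℕ → ℕ, StrictMono φ ∧ CauchySeq (u ∘ φ))
    (hR : ∀ [MeasurableSpace E] [BorelSpace E] [CompactSpace M] [T2Space M]
      (hJ : letI : RiemannianBundle (fun x : M ↦ TangentSpace 𝓘(ℝ, E) x) := ⟨g.toRiemannianMetric⟩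
        ∀ (x : M) (v w : TangentSpace 𝓘(ℝ, E) x),
          inner ℝ (tangentJ E x v) (tangentJ E x w) = inner ℝ v w)
      (p q : ℕ) (h : (p + q) + m = n)
      (ho : letI : RiemannianBundle (fun x : M ↦ TangentSpace 𝓘(ℝ, E) x) := ⟨g.toRiemannianMetric⟩
        IsSmoothForm (riemannianVolumeForm o)),
      letI : RiemannianBundle (fun x : M ↦ TangentSpace 𝓘(ℝ, E) x) := ⟨g.toRiemannianMetric⟩
      haveI : IsContMDiffRiemannianBundle 𝓘(ℝ, E) ∞ E (fun x : M ↦ TangentSpace 𝓘(ℝ, E) x) :=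
        ⟨g.inner, g.contMDiff, fun _ _ _ ↦ rfl⟩
      haveI : Fact (IsSmoothForm (riemannianVolumeForm o)) := ⟨ho⟩
      ∀ (α : CL2SmoothForms.pq o p q) (ℓ : CL2SmoothForms.pq o p q →L[ℂ] ℂ),
        (∀ φ, ℓ (CL2SmoothForms.pqLaplacian o hJ p q h φ) = ⟪α, φ⟫) →
          ∃ w : CL2SmoothForms.pq o p q, ∀ φ, ℓ φ = ⟪w, φ⟫) :
    existsUnique_isDolbeaultHarmonic_mk_eq (m := m) g o := by
  intro _ _ hg p q h
  letI : RiemannianBundle (fun x : M ↦ TangentSpace 𝓘(ℝ, E) x) := ⟨g.toRiemannianMetric⟩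
  haveI : IsContMDiffRiemannianBundle 𝓘(ℝ, E) ∞ E (fun x : M ↦ TangentSpace 𝓘(ℝ, E) x) :=
    ⟨g.inner, g.contMDiff, fun _ _ _ ↦ rfl⟩
  haveI : IsContinuousRiemannianBundle E (fun x : M ↦ TangentSpace 𝓘(ℝ, E) x) :=
    ⟨g.inner, g.contMDiff.continuous, fun _ _ _ ↦ rfl⟩
  intro ho c
  letI : MeasurableSpace E := borel E
  haveI : BorelSpace E := ⟨rfl⟩
  haveI : Fact (IsSmoothForm (riemannianVolumeForm o)) := ⟨ho⟩
  have hJ : ∀ (x : M) (v w : TangentSpace 𝓘(ℝ, E) x),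
      inner ℝ (tangentJ E x v) (tangentJ E x w) = inner ℝ v w := fun x v w ↦ hg x v w
  obtain ⟨η, hη, hηc⟩ := exists_isDolbeaultHarmonic_mk_eq_of_regularity_of_compactness o hJ h
    (hC hJ p q h ho) (hR hJ p q h ho) c
  refine ⟨η, ⟨hη, hηc⟩, fun β hβ ↦ ?_⟩
  exact isDolbeaultHarmonic_rep_unique o hJ ho h hβ.1 hη (hβ.2.trans hηc.symm)

omit [FiniteDimensional ℂ E] [Fact (finrank ℝ E = n)] in
/-- **Cartan–Serre finiteness `finite_dolbeaultCohomology` (the Dolbeault groups of every compact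
Hausdorff complex manifold are finite-dimensional; Voisin (2002), Cor. 5.25) from Warner's Theorems
6.5 and 6.6 for `Δ_∂̄` on the spaces `A^{p,q}`**, assumed for every finite-dimensional complex model,
every `C^∞` Riemannian metric `g` and orientation family `o` (the proof instantiates them at a
Hermitian metric, `exists_isHermitian_contMDiffRiemannianMetric`, and the complex orientation):
`finite_dolbeaultCohomology_of_hodgeTheory` fed with
`existsUnique_isDolbeaultHarmonic_mk_eq_of_regularity_of_compactness` and
`finite_dolbeaultHarmonicForms_of_compactness`. With it, the Frölicher inequality
`Literature.AlgebraicGeometry.Motives.finrank_complexDeRham_le_sum_hodgeNumber` follows from the same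
two analytic hypotheses (`finrank_complexDeRham_le_sum_hodgeNumber_of_finite`).
[cite: VoisinHodgeI2002, §5.3.1 Cor. 5.25] -/
theorem finite_dolbeaultCohomology_of_regularity_of_compactness
    (hC : ∀ [FiniteDimensional ℂ E] {n : ℕ} [Fact (finrank ℝ E = n)]
      (g : ContMDiffRiemannianMetric 𝓘(ℝ, E) ∞ E (fun x : M ↦ TangentSpace 𝓘(ℝ, E) x))
      (o : (x : M) → Orientation ℝ (TangentSpace 𝓘(ℝ, E) x) (Fin n)) {m : ℕ}
      [MeasurableSpace E] [BorelSpace E] [CompactSpace M] [T2Space M]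
      (hJ : letI : RiemannianBundle (fun x : M ↦ TangentSpace 𝓘(ℝ, E) x) := ⟨g.toRiemannianMetric⟩
        ∀ (x : M) (v w : TangentSpace 𝓘(ℝ, E) x),
          inner ℝ (tangentJ E x v) (tangentJ E x w) = inner ℝ v w)
      (p q : ℕ) (h : (p + q) + m = n)
      (ho : letI : RiemannianBundle (fun x : M ↦ TangentSpace 𝓘(ℝ, E) x) := ⟨g.toRiemannianMetric⟩
        IsSmoothForm (riemannianVolumeForm o)),
      letI : RiemannianBundle (fun x : M ↦ TangentSpace 𝓘(ℝ, E) x) := ⟨g.toRiemannianMetric⟩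
      haveI : IsContMDiffRiemannianBundle 𝓘(ℝ, E) ∞ E (fun x : M ↦ TangentSpace 𝓘(ℝ, E) x) :=
        ⟨g.inner, g.contMDiff, fun _ _ _ ↦ rfl⟩
      haveI : Fact (IsSmoothForm (riemannianVolumeForm o)) := ⟨ho⟩
      ∀ (u : ℕ → CL2SmoothForms.pq o p q) (c : ℝ), (∀ i, ‖u i‖ ≤ c) →
        (∀ i, ‖CL2SmoothForms.pqLaplacian o hJ p q h (u i)‖ ≤ c) →
          ∃ φ : ℕ → ℕ, StrictMono φ ∧ CauchySeq (u ∘ φ))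
    (hR : ∀ [FiniteDimensional ℂ E] {n : ℕ} [Fact (finrank ℝ E = n)]
      (g : ContMDiffRiemannianMetric 𝓘(ℝ, E) ∞ E (fun x : M ↦ TangentSpace 𝓘(ℝ, E) x))
      (o : (x : M) → Orientation ℝ (TangentSpace 𝓘(ℝ, E) x) (Fin n)) {m : ℕ}
      [MeasurableSpace E] [BorelSpace E] [CompactSpace M] [T2Space M]
      (hJ : letI : RiemannianBundle (fun x : M ↦ TangentSpace 𝓘(ℝ, E) x) := ⟨g.toRiemannianMetric⟩
        ∀ (x : M) (v w : TangentSpace 𝓘(ℝ, E) x),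
          inner ℝ (tangentJ E x v) (tangentJ E x w) = inner ℝ v w)
      (p q : ℕ) (h : (p + q) + m = n)
      (ho : letI : RiemannianBundle (fun x : M ↦ TangentSpace 𝓘(ℝ, E) x) := ⟨g.toRiemannianMetric⟩
        IsSmoothForm (riemannianVolumeForm o)),
      letI : RiemannianBundle (fun x : M ↦ TangentSpace 𝓘(ℝ, E) x) := ⟨g.toRiemannianMetric⟩
      haveI : IsContMDiffRiemannianBundle 𝓘(ℝ, E) ∞ E (fun x : M ↦ TangentSpace 𝓘(ℝ, E) x) :=
        ⟨g.inner, g.contMDiff, fun _ _ _ ↦ rfl⟩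
      haveI : Fact (IsSmoothForm (riemannianVolumeForm o)) := ⟨ho⟩
      ∀ (α : CL2SmoothForms.pq o p q) (ℓ : CL2SmoothForms.pq o p q →L[ℂ] ℂ),
        (∀ φ, ℓ (CL2SmoothForms.pqLaplacian o hJ p q h φ) = ⟪α, φ⟫) →
          ∃ w : CL2SmoothForms.pq o p q, ∀ φ, ℓ φ = ⟪w, φ⟫) :
    finite_dolbeaultCohomology (E := E) (M := M) :=
  finite_dolbeaultCohomology_of_hodgeTheory
    (fun g o ↦ existsUnique_isDolbeaultHarmonic_mk_eq_of_regularity_of_compactness g o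
      (fun hJ p q h ho ↦ hC g o hJ p q h ho) (fun hJ p q h ho ↦ hR g o hJ p q h ho))
    (fun g o ↦ finite_dolbeaultHarmonicForms_of_compactness o g
      (fun hJ p q h ho ↦ hC g o hJ p q h ho))

end NamedFacts

end Literature.NumberTheory.Transcendental
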